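import Summits.QuantumFields.BalabanUV.Beta.AxialProjectorBlockMean

/-!
# Bałaban's «two points of view» on the averaging as a kernel 2×2 table, and the UNIQUENESS of the two gauge maps
# (β sub-cell, lineage an1 = ANALYSIS PROVER AN1 «his averaging operators, his axial gauge fixing», gen 16; kernel half of the
# answer (R42-3) to NOTE X-an2-42)

HONEST FRAMING (cell charter, verbatim): «discharging BetaPertH makes Balaban's UV stability UNCONDITIONAL — a real
constructive-QFT result; it is NOT the continuum limit and NOT the Clay problem.»  DERIVED cell leaf over the cell's OWN typed
objects (an1's `AveragingContoursRooted`, an5's `RootedComb`, an2's `AxialProjectorBlockMean`, the lead's `AffineAveraging`, all BY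
NAME); no statement of Bałaban's papers is typed here, no `[cite:]` tag, no `Prop` fact, no binder of the β-function wall is
instantiated.  NOT `BetaPertH`; NOT continuum; NOT Clay.  The printed equations named below are LOCATORS for the reader
([Balaban1984PropagatorsI] = T. Bałaban, Propagators and renormalization transformations for lattice gauge theories I, CMP 95
(1984) 17–40, §A pp.19–20, §C pp.21–22), not citations of a disputed step.

## What is here (in-block root `ρ = toSite r`, `r ∈ {0,…,N−1}ⁿ`, real coefficients)

* §1 THE 2×2 TABLE.  Rows = the two dressings `Π_root := RootedComb.axProjAt ρ N` (tree gauge normalised to VANISH AT THE ROOTS)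
  and `Π_bm := AxialProjectorBlockMean.axProjBmAt ρ N` (tree gauge normalised to ZERO BLOCK MEANS); columns = the two averagings,
  the STRAIGHT block sum `AffineAveraging.contourSum N` (p.19 (1.11) `(QA)_c`, gauge law (1.13) `B^λ = B − ∂Q'λ`: `contourSum_dz`) and
  the ROOTED average `AveragingContoursRooted.linAvgAt ρ` (p.19 (1.8) `B_c`, gauge law (1.9) `B^λ = B − ∂λ`: `linAvgAt_grad`).
  an2's column (`contourSum_axProjBmAt`: preserved; `contourSum_axProjAt`: shifted by `− dz (blockSum N λ^ρ_A)`) is completed by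
  **`linAvgAt_axProjAt`** (preserved) and **`linAvgAt_axProjBmAt`** (shifted by `+ dz (blockSum N λ^ρ_A)`): each dressing preserves
  exactly ITS OWN averaging, and the two off-diagonal defects are the SAME coarse exact form with opposite signs
  (`LamAt_eq_blockSum_treeGaugeAt`: an1's rooted block potential `Λ^ρ` IS `blockSum N λ^ρ_A`).
* §2 UNIQUENESS OF THE GAUGE MAP (the one-step linear algebra behind p.21 (1.22)–(1.23), where `∫dλ′ δ(Q′_k λ′) ∏ δ_Ax(… + ∂Q′λ′)`
  integrates to an `A`-independent constant, and behind p.19 (1.9)–(1.10) «λ(y) = 0, y ∈ T_L^{(1)}» + `δ_Ax`).  Every gauge function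
  carrying `A` into the rooted axial gauge is the tree gauge plus a BLOCK-CONSTANT function (`eq_treeGaugeAt_add_of_axialGaugeAt`,
  from an1's `axialGaugeAt_rigid`); hence **`existsUnique_gauge_root`** (normalisation «λ = 0 at the roots» ⇒ `λ = treeGaugeAt`, the
  map is `Π_root`) and **`existsUnique_gauge_blockSum`** (normalisation «Q′λ = 0», i.e. `blockSum N λ = 0` ⇒ `λ = bmGaugeAt`, the
  map is `Π_bm`), with the `iff` forms.
* §3 THE DICTIONARY.  **`contourSum_eq_linAvgAt_axProjBmAt : contourSum N A = linAvgAt ρ (Π_bm A)`** — the typed straight constraint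
  of a field is Bałaban's rooted average of its Π_bm-dressed representative — and **`linAvgAt_eq_contourSum_axProjAt : linAvgAt ρ A =
  contourSum N (Π_root A)`** (the rooted twin of an2's `AxialProjector.linAvg_eq_contourSum_axProj` «Q_Bal = Q_typed ∘ Π_ax»); and the
  difference of the two averagings on a raw field, `contourSum N A − linAvgAt ρ A = dz (blockSum N λ^ρ_A)`.

WHY (X-an2-42, items (R42-1)/(R42-3)).  A resolvent whose constraint row is the STRAIGHT `contourSum` (the typed `KKTFluctuationKernel`
(Q)) is matched, as a gauge map back to the axial gauge, by `Π_bm` (§2: the unique `λ` with `Q′λ = 0`), and its constraint value is the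
rooted (1.8)-average of the Π_bm-dressed field (§3); `Π_root` is the gauge map matched to a constraint row given by the ROOTED average.
Nothing here rules on which pair the wall family carries — that is the β-lead's (R42-1).  All declarations `[folklore]`; axioms standard.
Provenance: b2b-balaban β sub-cell, lineage beta-an1 gen 16, 2026-08-19 (v1.1: the block-cardinality helper is inlined — v1's stand-alone copy collided by statement with an unrelated Literature lemma, `dedup.landed`); no existing file touched.
-/

open Finset
open scoped BigOperators
open Literature.MathematicalPhysics.QuantumFieldTheory
open Literature.MathematicalPhysics.QuantumFieldTheory.Balaban1983to89
open Literature.MathematicalPhysics.QuantumFieldTheory.Balaban1983to89.Beta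
open AffineAveraging (Site Form0 Form1 box toSite unitVec dz blockSum contourSum contourSum_dz)
open AveragingContours (blk off grad axial axial_sum_grad axial_sum_sub grad_eq_dz blk_block blk_add_off off_mem_box straightSum
  straightSum_eq_contourSum)
open AveragingContoursRooted (linAvgAt LamAt treeGaugeAt AxialGaugeAt linAvgAt_gauge linAvgAt_grad linAvgAt_sub axialGaugeAt_rigid
  linAvgAt_eq_straightSum_of_axialGaugeAt linAvgAt_eq_contourSum_sub_dz)
open RootedComb (axProjAt treeGaugeAt_block axialGaugeAt_axProjAt treeGaugeAt_root treeGaugeAt_eq_zero_of_axialGaugeAt)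
open Summit.QuantumFields.BalabanUV.Beta.AxialProjectorBlockMean

namespace Summit.QuantumFields.BalabanUV.Beta.AveragingPointsOfView

noncomputable section

variable {n : ℕ}

/-! ## §0 Small helpers -/

/-- [folklore] The root of the neighbouring block: `N·y + ρ + N·e_μ = N·(y + e_μ) + ρ`. -/
theorem root_add (N : ℕ) (ρ : Site n) (μ : Fin n) (y : Site n) :
    (N : ℤ) • y + ρ + (N : ℤ) • unitVec μ = (N : ℤ) • (y + unitVec μ) + ρ := by
  rw [smul_add]; abel

/-- [folklore] The block mean read at a ROOT is the block sum of that block over `Nⁿ`. -/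
theorem blockMeanAt_root {N : ℕ} {r : Fin n → ℕ} (hr : r ∈ box n N) (f : Form0 n ℝ) (y : Site n) :
    blockMeanAt N f ((N : ℤ) • y + toSite r) = blockSum N f y / ((N : ℝ) ^ n) := by
  simp only [blockMeanAt, blk_block y hr]

/-- [folklore] an1's rooted block potential `Λ^ρ(y) = Σ_{x∈B(y)} A(Γ_{r(y),x})` IS the block sum of the rooted tree gauge. -/
theorem LamAt_eq_blockSum_treeGaugeAt (N : ℕ) (r : Fin n → ℕ) (A : Form1 n ℝ) :
    LamAt (toSite r) A N = blockSum N (treeGaugeAt (toSite r) A N) := by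
  funext y
  simp only [LamAt, blockSum]
  exact Finset.sum_congr rfl fun b hb => (treeGaugeAt_block A y hb).symm

/-- [folklore] The block-mean-normalised tree gauge has vanishing block sums (an2's `blockSum_sub_blockMeanAt` BY NAME). -/
theorem blockSum_bmGaugeAt {N : ℕ} (hN : 1 ≤ N) (ρ : Site n) (A : Form1 n ℝ) : blockSum N (bmGaugeAt ρ A N) = 0 :=
  blockSum_sub_blockMeanAt hN _

/-! ## §1 The 2×2 table: the ROOTED averaging under the two dressings

(an2's `AxialProjectorBlockMean` §2 is the `contourSum` column; this is the `linAvgAt` column.) -/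

/-- [folklore] **THE ROOTED AVERAGE IS BLIND TO `Π_root`:** `linAvgAt ρ (Π_root A) = linAvgAt ρ A` — by (1.9)-from-the-root
(`linAvgAt_gauge`) the change is `#B ·` the coarse gradient of `λ^ρ_A` over the ROOT lattice, and `λ^ρ_A` vanishes there
(`treeGaugeAt_root`).  Rooted twin of an2's `AxialProjector.linAvg_axProj`. -/
theorem linAvgAt_axProjAt {N : ℕ} {r : Fin n → ℕ} (hr : r ∈ box n N) (A : Form1 n ℝ) (μ : Fin n) (y : Site n) :
    linAvgAt (toSite r) (axProjAt (toSite r) N A) N μ y = linAvgAt (toSite r) A N μ y := by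
  rw [axProjAt, linAvgAt_gauge, root_add, treeGaugeAt_root hr A, treeGaugeAt_root hr A]
  simp

/-- [folklore] **THE ROOTED AVERAGE SEES `Π_bm`:** `linAvgAt ρ (Π_bm A) = linAvgAt ρ A + dz (blockSum N λ^ρ_A)` — the mirror image of
an2's `contourSum_axProjAt : contourSum N (Π_root A) = contourSum N A − dz (blockSum N λ^ρ_A)`: the same coarse exact form, opposite sign. -/
theorem linAvgAt_axProjBmAt {N : ℕ} (hN : 1 ≤ N) {r : Fin n → ℕ} (hr : r ∈ box n N) (A : Form1 n ℝ) (μ : Fin n) (y : Site n) :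
    linAvgAt (toSite r) (axProjBmAt (toSite r) N A) N μ y
      = linAvgAt (toSite r) A N μ y + dz (blockSum N (treeGaugeAt (toSite r) A N)) μ y := by
  have hNn : ((N : ℝ) ^ n) ≠ 0 := pow_ne_zero _ (by exact_mod_cast (show N ≠ 0 by omega))
  have hcard : (box n N).card = N ^ n := by
    simp only [AffineAveraging.box, Fintype.card_piFinset, Finset.card_range, Finset.prod_const, Finset.card_univ,
      Fintype.card_fin]
  unfold axProjBmAt bmGaugeAt
  rw [linAvgAt_gauge, root_add]
  simp only [Pi.sub_apply, treeGaugeAt_root hr A, blockMeanAt_root hr, hcard, nsmul_eq_mul, dz]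
  push_cast
  field_simp
  ring

/-- [folklore] The two off-diagonal defects cancel: `linAvgAt ρ (Π_bm A) − linAvgAt ρ A = contourSum N A − contourSum N (Π_root A)`. -/
theorem defect_linAvgAt_eq_defect_contourSum {N : ℕ} (hN : 1 ≤ N) {r : Fin n → ℕ} (hr : r ∈ box n N) (A : Form1 n ℝ)
    (μ : Fin n) (y : Site n) :
    linAvgAt (toSite r) (axProjBmAt (toSite r) N A) N μ y - linAvgAt (toSite r) A N μ y
      = contourSum N A μ y - contourSum N (axProjAt (toSite r) N A) μ y := by
  rw [linAvgAt_axProjBmAt hN hr, contourSum_axProjAt]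
  simp only [Pi.sub_apply]
  ring

/-! ## §2 Uniqueness of the gauge map into the rooted axial gauge, under either normalisation -/

/-- [folklore] **STRUCTURE:** if `A − grad λ` is in the rooted axial gauge, then `λ` is the rooted tree gauge of `A` plus a
BLOCK-CONSTANT function — its own values at the roots (an1's `axialGaugeAt_rigid` applied to `Π_root A` and `λ − λ^ρ_A`). -/
theorem eq_treeGaugeAt_add_of_axialGaugeAt {N : ℕ} (hN : 1 ≤ N) {r : Fin n → ℕ} (hr : r ∈ box n N) {A : Form1 n ℝ}
    {lam : Form0 n ℝ} (h : AxialGaugeAt (toSite r) (A - grad lam) N) (x : Site n) :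
    lam x = treeGaugeAt (toSite r) A N x + lam ((N : ℤ) • blk N x + toSite r) := by
  have hax : AxialGaugeAt (toSite r) (axProjAt (toSite r) N A) N := axialGaugeAt_axProjAt hr A
  have h' : AxialGaugeAt (toSite r) (axProjAt (toSite r) N A - grad (lam - treeGaugeAt (toSite r) A N)) N := by
    have e : axProjAt (toSite r) N A - grad (lam - treeGaugeAt (toSite r) A N) = A - grad lam := by
      rw [axProjAt, grad_sub]; abel
    rw [e]; exact h
  have key := axialGaugeAt_rigid hax h' (blk N x) (off_mem_box hN x)
  rw [blk_add_off hN x] at key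
  simp only [Pi.sub_apply, treeGaugeAt_root hr A, sub_zero] at key
  linarith

/-- [folklore] Hence the block sums of such a `λ`: `blockSum N λ y = blockSum N λ^ρ_A y + Nⁿ · λ(root of block y)`. -/
theorem blockSum_eq_of_axialGaugeAt {N : ℕ} (hN : 1 ≤ N) {r : Fin n → ℕ} (hr : r ∈ box n N) {A : Form1 n ℝ} {lam : Form0 n ℝ}
    (h : AxialGaugeAt (toSite r) (A - grad lam) N) (y : Site n) :
    blockSum N lam y = blockSum N (treeGaugeAt (toSite r) A N) y + ((N : ℝ) ^ n) * lam ((N : ℤ) • y + toSite r) := by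
  have hsum : ∀ b ∈ box n N, lam ((N : ℤ) • y + toSite b)
      = treeGaugeAt (toSite r) A N ((N : ℤ) • y + toSite b) + lam ((N : ℤ) • y + toSite r) := by
    intro b hb
    rw [eq_treeGaugeAt_add_of_axialGaugeAt hN hr h ((N : ℤ) • y + toSite b), blk_block y hb]
  have hcard : (box n N).card = N ^ n := by
    simp only [AffineAveraging.box, Fintype.card_piFinset, Finset.card_range, Finset.prod_const, Finset.card_univ,
      Fintype.card_fin]
  simp only [blockSum]
  rw [Finset.sum_congr rfl hsum, Finset.sum_add_distrib, Finset.sum_const, hcard, nsmul_eq_mul]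
  push_cast
  ring

/-- [folklore] **NORMALISATION «λ = 0 AT THE ROOTS» (p.19 (1.9): «λ(y) = 0, y ∈ T_L^{(1)}») PICKS THE TREE GAUGE.** -/
theorem eq_treeGaugeAt_of_root {N : ℕ} (hN : 1 ≤ N) {r : Fin n → ℕ} (hr : r ∈ box n N) {A : Form1 n ℝ} {lam : Form0 n ℝ}
    (h : AxialGaugeAt (toSite r) (A - grad lam) N) (hroot : ∀ y : Site n, lam ((N : ℤ) • y + toSite r) = 0) :
    lam = treeGaugeAt (toSite r) A N := by
  funext x
  rw [eq_treeGaugeAt_add_of_axialGaugeAt hN hr h x, hroot, add_zero]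

/-- [folklore] **NORMALISATION «ZERO BLOCK SUMS» (p.19 (1.13)/p.21 (1.22): «(Q′λ)(y) = 0») PICKS THE BLOCK-MEAN-NORMALISED TREE GAUGE.** -/
theorem eq_bmGaugeAt_of_blockSum {N : ℕ} (hN : 1 ≤ N) {r : Fin n → ℕ} (hr : r ∈ box n N) {A : Form1 n ℝ} {lam : Form0 n ℝ}
    (h : AxialGaugeAt (toSite r) (A - grad lam) N) (hbs : blockSum N lam = 0) :
    lam = bmGaugeAt (toSite r) A N := by
  have hNn : ((N : ℝ) ^ n) ≠ 0 := pow_ne_zero _ (by exact_mod_cast (show N ≠ 0 by omega))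
  funext x
  have hb := blockSum_eq_of_axialGaugeAt hN hr h (blk N x)
  rw [hbs, Pi.zero_apply] at hb
  have hroot : lam ((N : ℤ) • blk N x + toSite r) = -blockSum N (treeGaugeAt (toSite r) A N) (blk N x) / ((N : ℝ) ^ n) := by
    rw [eq_div_iff hNn, mul_comm]
    linarith
  rw [eq_treeGaugeAt_add_of_axialGaugeAt hN hr h x, hroot]
  unfold bmGaugeAt
  simp only [Pi.sub_apply, blockMeanAt]
  ring

/-- [folklore] **`Π_root` IS THE UNIQUE GAUGE MAP NORMALISED AT THE ROOTS** (`iff` form). -/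
theorem axialGaugeAt_iff_eq_treeGaugeAt {N : ℕ} (hN : 1 ≤ N) {r : Fin n → ℕ} (hr : r ∈ box n N) (A : Form1 n ℝ)
    {lam : Form0 n ℝ} (hroot : ∀ y : Site n, lam ((N : ℤ) • y + toSite r) = 0) :
    AxialGaugeAt (toSite r) (A - grad lam) N ↔ lam = treeGaugeAt (toSite r) A N := by
  constructor
  · intro h; exact eq_treeGaugeAt_of_root hN hr h hroot
  · rintro rfl; exact axialGaugeAt_axProjAt hr A

/-- [folklore] **`Π_bm` IS THE UNIQUE GAUGE MAP NORMALISED TO ZERO BLOCK SUMS** (`iff` form). -/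
theorem axialGaugeAt_iff_eq_bmGaugeAt {N : ℕ} (hN : 1 ≤ N) {r : Fin n → ℕ} (hr : r ∈ box n N) (A : Form1 n ℝ)
    {lam : Form0 n ℝ} (hbs : blockSum N lam = 0) :
    AxialGaugeAt (toSite r) (A - grad lam) N ↔ lam = bmGaugeAt (toSite r) A N := by
  constructor
  · intro h; exact eq_bmGaugeAt_of_blockSum hN hr h hbs
  · rintro rfl; exact axialGaugeAt_axProjBmAt hN hr A

/-- [folklore] **∃! (root normalisation):** exactly one `λ` vanishing at every root carries `A` into the rooted axial gauge. -/
theorem existsUnique_gauge_root {N : ℕ} (hN : 1 ≤ N) {r : Fin n → ℕ} (hr : r ∈ box n N) (A : Form1 n ℝ) :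
    ∃! lam : Form0 n ℝ, (∀ y : Site n, lam ((N : ℤ) • y + toSite r) = 0) ∧ AxialGaugeAt (toSite r) (A - grad lam) N :=
  ⟨treeGaugeAt (toSite r) A N, ⟨treeGaugeAt_root hr A, axialGaugeAt_axProjAt hr A⟩,
    fun _ hl => eq_treeGaugeAt_of_root hN hr hl.2 hl.1⟩

/-- [folklore] **∃! (block-sum normalisation):** exactly one `λ` with vanishing block sums carries `A` into the rooted axial gauge
— the one-step content of «`∫dλ′ δ(Q′λ′) δ_Ax(A + ∂λ′)` is a constant» in p.21 (1.23). -/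
theorem existsUnique_gauge_blockSum {N : ℕ} (hN : 1 ≤ N) {r : Fin n → ℕ} (hr : r ∈ box n N) (A : Form1 n ℝ) :
    ∃! lam : Form0 n ℝ, blockSum N lam = 0 ∧ AxialGaugeAt (toSite r) (A - grad lam) N :=
  ⟨bmGaugeAt (toSite r) A N, ⟨blockSum_bmGaugeAt hN _ A, axialGaugeAt_axProjBmAt hN hr A⟩,
    fun _ hl => eq_bmGaugeAt_of_blockSum hN hr hl.2 hl.1⟩

/-! ## §3 The dictionary between the typed straight constraint and Bałaban's rooted average -/

/-- [folklore] **THE TYPED STRAIGHT CONSTRAINT OF A FIELD IS BAŁABAN'S ROOTED AVERAGE OF ITS `Π_bm`-DRESSED REPRESENTATIVE:**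
`contourSum N A μ y = linAvgAt ρ (Π_bm A) N μ y` (on the rooted-axial field `Π_bm A` the two points of view coincide, an1's
`linAvgAt_eq_straightSum_of_axialGaugeAt`, and `Π_bm` preserves `contourSum`, an2's `contourSum_axProjBmAt`). -/
theorem contourSum_eq_linAvgAt_axProjBmAt {N : ℕ} (hN : 1 ≤ N) {r : Fin n → ℕ} (hr : r ∈ box n N) (A : Form1 n ℝ)
    (μ : Fin n) (y : Site n) :
    contourSum N A μ y = linAvgAt (toSite r) (axProjBmAt (toSite r) N A) N μ y := by
  rw [linAvgAt_eq_straightSum_of_axialGaugeAt (axialGaugeAt_axProjBmAt hN hr A), straightSum_eq_contourSum,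
    contourSum_axProjBmAt (toSite r) hN A]

/-- [folklore] **BAŁABAN'S ROOTED AVERAGE OF A FIELD IS THE TYPED STRAIGHT CONSTRAINT OF ITS `Π_root`-DRESSED REPRESENTATIVE:**
`linAvgAt ρ A N μ y = contourSum N (Π_root A) μ y` (rooted twin of an2's `AxialProjector.linAvg_eq_contourSum_axProj`). -/
theorem linAvgAt_eq_contourSum_axProjAt {N : ℕ} {r : Fin n → ℕ} (hr : r ∈ box n N) (A : Form1 n ℝ) (μ : Fin n) (y : Site n) :
    linAvgAt (toSite r) A N μ y = contourSum N (axProjAt (toSite r) N A) μ y := by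
  rw [← linAvgAt_axProjAt hr A μ y, linAvgAt_eq_straightSum_of_axialGaugeAt (axialGaugeAt_axProjAt hr A),
    straightSum_eq_contourSum]

/-- [folklore] **THE TWO AVERAGINGS OF A RAW FIELD DIFFER BY THE COARSE EXACT FORM `dz (blockSum N λ^ρ_A)`** (an1's
`linAvgAt_eq_contourSum_sub_dz` with `Λ^ρ = blockSum N λ^ρ_A`). -/
theorem contourSum_sub_linAvgAt {N : ℕ} (r : Fin n → ℕ) (A : Form1 n ℝ) (μ : Fin n) (y : Site n) :
    contourSum N A μ y - linAvgAt (toSite r) A N μ y = dz (blockSum N (treeGaugeAt (toSite r) A N)) μ y := by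
  rw [linAvgAt_eq_contourSum_sub_dz, LamAt_eq_blockSum_treeGaugeAt]
  ring

end

end Summit.QuantumFields.BalabanUV.Beta.AveragingPointsOfView
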